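import Literature.NumberTheory.LFunctions.DirichletXiPairMultiplicity
import Literature.NumberTheory.LFunctions.DirichletXiPairLogDerivSeries
import Literature.NumberTheory.LFunctions.DirichletLZeroCountingTwoSided
import Literature.NumberTheory.LFunctions.ZetaLogDerivRePartialFraction
import Literature.NumberTheory.LFunctions.DirichletLFunctionBounds
import HarnessLib

/-!
# The global partial-fraction bound for `−L'/L(σ, χ)` at a real zero, WITH the partner zero
# `1 − β₁`, and the companion bound for `−ζ'/ζ(σ)` (Davenport Ch. 12, de la Vallée Poussin)

Topic `Literature/NumberTheory/LFunctions` (namespace `Literature.NumberTheory.LFunctions`,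
sub-namespace `DirichletTheta` for the `ξ(s, χ)` statements). Everything here is PROVED; no
definitions, no named facts. **RH-free, GRH-free.**

Let `χ` be a primitive character mod `q` (`χ ≠ 1`) and let `β₁` be a REAL zero of `L(s, χ)` with
`0 < β₁`, `β₁ ≠ ½`; let `σ > 1` be real. Davenport's partial-fraction formula (Ch. 12 (17)–(18);
McCurley 1984 Lemma 5 «From Davenport [2] we have …») gives
`−Re L'/L(σ, χ) = ½ log(q/π) + ½ Re Γ'/Γ((σ+κ)/2) − Σ_ρ Re 1/(σ−ρ)` with every `Re 1/(σ−ρ) > 0`.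
The classical use keeps only `ρ = β₁`. Here we keep ALSO the zero `1 − β₁` (a zero of `L(s, χ)` by
the functional equation and reality of `β₁`), which is distinct from `β₁` when `β₁ ≠ ½`:

* `DirichletTheta.two_mul_le_re_logDeriv_xiPair` — for the even pair `Ξ_χ = ξ(·,χ)ξ(·,χ̄)` and
  its PROVED genus-zero Hadamard product (`DirichletXiPairHadamard.lean`, `…Zeros.lean`,
  `…Multiplicity.lean`): `2·(1/(σ−β₁) + 1/(σ−1+β₁)) ≤ Re Ξ_χ'/Ξ_χ(σ)` (all partial-fraction terms
  have non-negative real part at real `σ > 1`; the Hadamard indices through `β₁` and `1 − β₁` are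
  at least `m_χ(β₁) + m_χ̄(β₁) ≥ 2` in number, each contributing `1/(σ−β₁) + 1/(σ−1+β₁)`);
* `DirichletTheta.neg_re_logDeriv_LFunction_le_of_realZero` — **the bound**
  `−Re L'/L(σ, χ) ≤ ½ log q + Re Γ_ℝ'/Γ_ℝ(σ + κ) − 1/(σ−β₁) − 1/(σ−1+β₁)`
  (`Γ_ℝ'/Γ_ℝ(w) = −½ log π + ½ ψ(w/2)`, `κ` the parity), via `ξ'/ξ = ½ log q + Γ_ℝ'/Γ_ℝ + L'/L`
  (`logDeriv_dirichletXi_eq`) for `χ` and `χ̄` and `Re L'/L(σ, χ̄) = Re L'/L(σ, χ)`;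
* `neg_logDeriv_riemannZeta_re_le` — `−ζ'/ζ(σ) ≤ 1/(σ−1) − ½ log π + ½ Re ψ(σ/2 + 1)` for real
  `σ > 1` (Kadiri's (1.1) with multiplicities, `re_neg_logDeriv_zeta_hadamard`, every zero dropped);
* `tsum_vonMangoldt_one_add_re_div_rpow_eq` — the Dirichlet series
  `Σ_n Λ(n)(1 + Re χ(n))/n^σ = Re(−ζ'/ζ(σ)) + Re(−L'/L(σ, χ))` (`σ > 1`);
* `tsum_vonMangoldt_one_add_re_div_rpow_le_of_realZero` — the three combined:
  `Σ_n Λ(n)(1 + Re χ(n))/n^σ ≤ 1/(σ−1) − ½ log π + ½ Re ψ(σ/2+1) + ½ log q + Re Γ_ℝ'/Γ_ℝ(σ+κ)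
   − 1/(σ−β₁) − 1/(σ−1+β₁)`.

Use: the left side is the series of Lu–Zaman–Zhao's Theorem 2.1 (`LuZamanZhao2026.theorem21`); the
partner term `1/(σ−1+β₁) ≥ 1/σ` makes this classical bound SMALLER than their printed Table-1 bound
for every modulus `q ≤ 4·10⁵` (numerics in a sibling file), so the kernel-replayed certificates of
the `parity-realchar` cell apply without the printed theorem.

## References

* H. Davenport, *Multiplicative Number Theory*, 3rd ed., Springer GTM 74, Ch. 12 (17)–(18) and
  Ch. 14 (the inequality `−L'/L(σ,χ) < ½ log q − 1/(σ−β) + O(1)`). [DavenportMNT1980]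
* K. S. McCurley, *Explicit zero-free regions for Dirichlet L-functions*, J. Number Theory 19
  (1984) 7–32, Lemmas 5, 8, 9. [cite: McCurley1984ZFR, Lemma 5]
* H. Kadiri, *Une région explicite sans zéros pour la fonction ζ de Riemann*, Acta Arith. 117
  (2005), (1.1). [Kadiri2005]
* H. L. Montgomery, R. C. Vaughan, *Multiplicative Number Theory I*, CUP 2007, §10.2 (10.29),
  Cor. 10.8. [MontgomeryVaughan2007]
-/

noncomputable section

open Complex Filter Topology Set
open scoped ComplexConjugate

namespace Literature.NumberTheory.LFunctions

namespace DirichletTheta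

variable {q : ℕ} [NeZero q] {χ : DirichletCharacter ℂ q}

/-! ### Real parts of the partial-fraction terms at a real point right of the strip -/

/-- `Re 1/(σ − ρ) ≥ 0` for `Re ρ < σ`. [folklore] -/
private theorem re_inv_ofReal_sub_nonneg {σ : ℝ} {ρ : ℂ} (h : ρ.re < σ) :
    0 ≤ (((σ : ℂ) - ρ)⁻¹).re := by
  rw [Complex.inv_re]
  refine div_nonneg ?_ (Complex.normSq_nonneg _)
  simp only [sub_re, ofReal_re]
  linarith

/-- `1/(σ − β) + 1/(σ − (1 − β))` as a complex number is the real `1/(σ−β) + 1/(σ−1+β)`. [folklore] -/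
private theorem inv_add_inv_ofReal (σ β : ℝ) :
    ((σ : ℂ) - (β : ℂ))⁻¹ + ((σ : ℂ) - (1 - (β : ℂ)))⁻¹ =
      ((1 / (σ - β) + 1 / (σ - 1 + β) : ℝ) : ℂ) := by
  have e1 : (σ : ℂ) - (β : ℂ) = ((σ - β : ℝ) : ℂ) := by push_cast; ring
  have e2 : (σ : ℂ) - (1 - (β : ℂ)) = ((σ - 1 + β : ℝ) : ℂ) := by push_cast; ring
  rw [e1, e2, ← Complex.ofReal_inv, ← Complex.ofReal_inv, ← Complex.ofReal_add]
  push_cast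
  ring

omit [NeZero q] in
/-- The inverse of a primitive character is primitive. [folklore] -/
private theorem isPrimitive_inv_of_isPrimitive (hχ : χ.IsPrimitive) : χ⁻¹.IsPrimitive := by
  rw [DirichletCharacter.isPrimitive_def, DirichletCharacter.conductor_inv]
  exact hχ

/-- A real zero `β₁ > 0` of `L(s, χ)` is a zero of `Ξ_χ` (`χ ≠ 1`): `ξ(β₁, χ) = 0` off the trivial
zeros. [cite: MontgomeryVaughan2007, (10.19)] -/
private theorem xiPair_ofReal_eq_zero (h1 : χ ≠ 1) {β₁ : ℝ} (hβ0 : 0 < β₁)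
    (hL : χ.LFunction β₁ = 0) : xiPair χ β₁ = 0 := by
  have hs : ∀ n : ℕ, (β₁ : ℂ) + charParity χ ≠ -(2 * n) := by
    intro n h
    have h' := congrArg Complex.re h
    simp at h'
    have : (0 : ℝ) ≤ n := Nat.cast_nonneg n
    have hκ : (0 : ℝ) ≤ charParity χ := Nat.cast_nonneg _
    linarith
  show dirichletXi χ β₁ * dirichletXi χ⁻¹ β₁ = 0
  rw [(dirichletXi_eq_zero_iff h1 hs).2 hL, zero_mul]

/-- A real zero of `L(s, χ)` is a zero of `L(s, χ̄)` (`χ ≠ 1`; `\overline{L(s̄, χ)} = L(s, χ̄)`).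
[cite: MontgomeryVaughan2007, §10.1 p. 334] -/
private theorem LFunction_inv_ofReal_eq_zero (h1 : χ ≠ 1) {β₁ : ℝ} (hL : χ.LFunction β₁ = 0) :
    χ⁻¹.LFunction β₁ = 0 := by
  have h := DirichletZFR.conj_LFunction_conj χ h1 (β₁ : ℂ)
  rw [Complex.conj_ofReal, hL, map_zero] at h
  exact h.symm

/-! ### The pair `Ξ_χ`: two Hadamard indices through a real zero -/

/-- **Partner-zero lower bound for `Re Ξ_χ'/Ξ_χ(σ)`.** Let `χ` be primitive, `χ ≠ 1`, let
`β₁ > 0`, `β₁ ≠ ½` be a real zero of `L(s, χ)`, and `σ > 1` real. Then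
`2·(1/(σ−β₁) + 1/(σ−1+β₁)) ≤ Re Ξ_χ'/Ξ_χ(σ)`. Proof: the PROVED partial-fraction series
`Ξ_χ'/Ξ_χ(σ) = Σₙ Tₙ(σ)` over a Hadamard sequence of `Ξ_χ` (`logDeriv_xiPair_eq_tsum`), whose non-zero
terms are `1/(σ−ρₙ) + 1/(σ−(1−ρₙ))` with `0 < Re ρₙ < 1` (non-negative real parts); the indices `n`
with `ρₙ = β₁` or `1 − ρₙ = β₁` number `m_χ(β₁) + m_χ̄(β₁) ≥ 2` (`ncard_index_add_ncard_index_eq`;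
the two index sets are disjoint as `β₁ ≠ ½`), and each contributes `1/(σ−β₁) + 1/(σ−1+β₁)`.
[cite: MontgomeryVaughan2007, §10.2 (10.29)] -/
theorem two_mul_le_re_logDeriv_xiPair (hχ : χ.IsPrimitive) (h1 : χ ≠ 1) {β₁ : ℝ} (hβ0 : 0 < β₁)
    (hβhalf : β₁ ≠ 1 / 2) (hL : χ.LFunction β₁ = 0) {σ : ℝ} (hσ : 1 < σ) :
    2 * (1 / (σ - β₁) + 1 / (σ - 1 + β₁)) ≤ (logDeriv (xiPair χ) σ).re := by
  classical
  obtain ⟨b, hbs, -, hmult, hprod⟩ := exists_xiPair_hadamardSeq hχ h1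
  have h2 : xiPair χ 2 ≠ 0 := xiPair_two_ne_zero hχ h1
  have h1' : χ⁻¹ ≠ 1 := inv_ne_one.mpr h1
  -- `Ξ_χ(σ) ≠ 0`, `Ξ_χ(β₁) = 0`
  have hΞσ : xiPair χ σ ≠ 0 := by
    intro h
    have := (re_mem_Ioo_of_xiPair_eq_zero hχ h1 h).2
    simp only [ofReal_re] at this
    linarith
  have hΞβ : xiPair χ (β₁ : ℂ) = 0 := xiPair_ofReal_eq_zero h1 hβ0 hL
  -- the series
  set T : ℕ → ℂ := fun n ↦
    -(2 * b n * ((σ : ℂ) - 1 / 2)) / (1 - b n * (((σ : ℂ) - 1 / 2) ^ 2 - 9 / 4)) with hTdef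
  have hT : logDeriv (xiPair χ) σ = ∑' n, T n := logDeriv_xiPair_eq_tsum hbs h2 h1 hprod hΞσ
  have hTs : Summable T := summable_logDeriv_factor hbs (9 / 4) ((σ : ℂ) - 1 / 2)
  have hTs' : Summable fun n ↦ (T n).re := (Complex.hasSum_re hTs.hasSum).summable
  have hfac : ∀ n, 1 - b n * (((σ : ℂ) - 1 / 2) ^ 2 - 9 / 4) ≠ 0 :=
    factor_ne_zero_of_xiPair_ne_zero h2 hprod hΞσ
  have hTn : ∀ n, b n ≠ 0 →
      T n = ((σ : ℂ) - xiPairZero b n)⁻¹ + ((σ : ℂ) - (1 - xiPairZero b n))⁻¹ :=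
    fun n hn ↦ term_eq_inv_add_inv b hn (hfac n)
  have hρ : ∀ n, b n ≠ 0 → 0 < (xiPairZero b n).re ∧ (xiPairZero b n).re < 1 :=
    fun n hn ↦ re_mem_Ioo_of_xiPair_eq_zero hχ h1 (xiPair_xiPairZero h2 hprod hn)
  -- non-negativity of every term
  have hnonneg : ∀ n, 0 ≤ (T n).re := by
    intro n
    by_cases hn : b n = 0
    · simp [hTdef, hn]
    · rw [hTn n hn, add_re]
      obtain ⟨h0, h1''⟩ := hρ n hn
      refine add_nonneg (re_inv_ofReal_sub_nonneg (by linarith)) (re_inv_ofReal_sub_nonneg ?_)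
      simp only [sub_re, one_re]
      linarith
  -- the value at an index through `β₁`
  set F : ℝ := 1 / (σ - β₁) + 1 / (σ - 1 + β₁) with hFdef
  have hval : ∀ n, b n ≠ 0 → (xiPairZero b n = β₁ ∨ 1 - xiPairZero b n = β₁) → (T n).re = F := by
    intro n hn h
    rw [hTn n hn]
    rcases h with h | h
    · rw [h, inv_add_inv_ofReal, ofReal_re]
    · have e : xiPairZero b n = 1 - (β₁ : ℂ) := by rw [← h]; ring
      rw [e, sub_sub_cancel, add_comm, inv_add_inv_ofReal, ofReal_re]
  -- the two index sets
  set A : Set ℕ := {k : ℕ | b k ≠ 0 ∧ xiPairZero b k = β₁} with hAdef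
  set B : Set ℕ := {k : ℕ | b k ≠ 0 ∧ 1 - xiPairZero b k = β₁} with hBdef
  have hcard : A.ncard + B.ncard =
      DirichletDisc.zeroOrder χ β₁ + DirichletDisc.zeroOrder χ⁻¹ β₁ :=
    ncard_index_add_ncard_index_eq hχ h1 hmult hΞβ
  have hm1 : 0 < DirichletDisc.zeroOrder χ β₁ := (DirichletDisc.zeroOrder_pos_iff χ h1 _).2 hL
  have hm2 : 0 < DirichletDisc.zeroOrder χ⁻¹ β₁ :=
    (DirichletDisc.zeroOrder_pos_iff χ⁻¹ h1' _).2 (LFunction_inv_ofReal_eq_zero h1 hL)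
  have hAB : Disjoint A B := by
    rw [Set.disjoint_left]
    rintro k ⟨-, hk⟩ ⟨-, hk'⟩
    apply hβhalf
    rw [hk] at hk'
    have h' := congrArg Complex.re hk'
    simp only [sub_re, one_re, ofReal_re] at h'
    linarith
  have hmemF : ∀ k ∈ A ∪ B, (T k).re = F := by
    rintro k (⟨hk0, hk⟩ | ⟨hk0, hk⟩)
    · exact hval k hk0 (Or.inl hk)
    · exact hval k hk0 (Or.inr hk)
  -- two distinct indices in `A ∪ B`
  have htwo : ∃ k₁ k₂ : ℕ, k₁ ≠ k₂ ∧ k₁ ∈ A ∪ B ∧ k₂ ∈ A ∪ B := by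
    by_cases hfin : (A ∪ B).Finite
    · have hA : A.Finite := hfin.subset Set.subset_union_left
      have hB : B.Finite := hfin.subset Set.subset_union_right
      have hc : 1 < (A ∪ B).ncard := by
        rw [Set.ncard_union_eq hAB hA hB]; omega
      obtain ⟨k₁, k₂, hk₁, hk₂, hne⟩ := (Set.one_lt_ncard_iff hfin).1 hc
      exact ⟨k₁, k₂, hne, hk₁, hk₂⟩
    · obtain ⟨k₁, hk₁, k₂, hk₂, hne⟩ := Set.Infinite.nontrivial hfin
      exact ⟨k₁, k₂, hne, hk₁, hk₂⟩
  obtain ⟨k₁, k₂, hne, hk₁, hk₂⟩ := htwo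
  -- the finite sub-sum over `{k₁, k₂}` bounds the series of non-negative terms from below
  have hsub : ∑ n ∈ ({k₁, k₂} : Finset ℕ), (T n).re ≤ ∑' n, (T n).re :=
    hTs'.sum_le_tsum _ (fun n _ ↦ hnonneg n)
  rw [Finset.sum_pair hne, hmemF k₁ hk₁, hmemF k₂ hk₂] at hsub
  rw [hT, Complex.re_tsum hTs]
  linarith

/-! ### The bound for `−Re L'/L(σ, χ)` -/

/-- `Re L'/L(σ, χ̄) = Re L'/L(σ, χ)` at a real point (`χ ≠ 1`). [cite: MontgomeryVaughan2007, §10.1 p. 334] -/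
private theorem re_logDeriv_LFunction_inv_ofReal (h1 : χ ≠ 1) (σ : ℝ) :
    (logDeriv χ⁻¹.LFunction σ).re = (logDeriv χ.LFunction σ).re := by
  have h := logDeriv_LFunction_conj (χ := χ) h1 (σ : ℂ)
  rw [Complex.conj_ofReal] at h
  rw [h, Complex.conj_re]

/-- **The global inequality with the partner zero.** Let `χ` be a primitive character mod `q`,
`χ ≠ 1`, with parity `κ`; let `β₁` be a real zero of `L(s, χ)` with `0 < β₁`, `β₁ ≠ ½`; and let
`σ > 1` be real. Then
`−Re L'/L(σ, χ) ≤ ½ log q + Re Γ_ℝ'/Γ_ℝ(σ + κ) − 1/(σ − β₁) − 1/(σ − 1 + β₁)`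
(Davenport Ch. 12 (17): `−Re L'/L = ½ log(q/π) + ½ Re Γ'/Γ((s+κ)/2) − Σ_ρ Re 1/(s−ρ)`, all terms of
the zero sum positive at real `s = σ > 1`, the zeros `β₁` and `1 − β₁` kept).
[cite: McCurley1984ZFR, Lemma 5] -/
theorem neg_re_logDeriv_LFunction_le_of_realZero (hχ : χ.IsPrimitive) (h1 : χ ≠ 1) {β₁ : ℝ}
    (hβ0 : 0 < β₁) (hβhalf : β₁ ≠ 1 / 2) (hL : χ.LFunction β₁ = 0) {σ : ℝ} (hσ : 1 < σ) :
    (-logDeriv χ.LFunction σ).re ≤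
      Real.log q / 2 + (logDeriv Gammaℝ ((σ : ℂ) + charParity χ)).re
        - 1 / (σ - β₁) - 1 / (σ - 1 + β₁) := by
  have h := two_mul_le_re_logDeriv_xiPair hχ h1 hβ0 hβhalf hL hσ
  have h1' : χ⁻¹ ≠ 1 := inv_ne_one.mpr h1
  have hχ' : χ⁻¹.IsPrimitive := isPrimitive_inv_of_isPrimitive hχ
  have hσre : 0 < ((σ : ℂ)).re := by simp only [ofReal_re]; linarith
  have hσ1 : (1 : ℝ) ≤ ((σ : ℂ)).re := by simp only [ofReal_re]; exact hσ.le
  have hLσ : χ.LFunction σ ≠ 0 :=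
    DirichletCharacter.LFunction_ne_zero_of_one_le_re χ (Or.inl h1) hσ1
  have hLσ' : χ⁻¹.LFunction σ ≠ 0 :=
    DirichletCharacter.LFunction_ne_zero_of_one_le_re χ⁻¹ (Or.inl h1') hσ1
  have hξ : dirichletXi χ σ ≠ 0 := dirichletXi_ne_zero_of_not_mem_strip hχ h1 (Or.inr hσ1)
  have hξ' : dirichletXi χ⁻¹ σ ≠ 0 := dirichletXi_ne_zero_of_not_mem_strip hχ' h1' (Or.inr hσ1)
  have hmul : logDeriv (xiPair χ) σ = logDeriv (dirichletXi χ) σ + logDeriv (dirichletXi χ⁻¹) σ := by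
    have hfun : xiPair χ = fun s ↦ dirichletXi χ s * dirichletXi χ⁻¹ s := rfl
    rw [hfun, logDeriv_mul (σ : ℂ) hξ hξ' (differentiable_dirichletXi h1 _)
      (differentiable_dirichletXi h1' _)]
  have e1 : logDeriv (dirichletXi χ) σ =
      (Real.log q : ℂ) / 2 + logDeriv Gammaℝ ((σ : ℂ) + charParity χ) + logDeriv χ.LFunction σ := by
    rw [logDeriv_apply]; exact logDeriv_dirichletXi_eq h1 hσre hLσ
  have e2 : logDeriv (dirichletXi χ⁻¹) σ =
      (Real.log q : ℂ) / 2 + logDeriv Gammaℝ ((σ : ℂ) + charParity χ) + logDeriv χ⁻¹.LFunction σ := by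
    rw [logDeriv_apply, ← charParity_inv χ]; exact logDeriv_dirichletXi_eq h1' hσre hLσ'
  have hre := congrArg Complex.re hmul
  rw [e1, e2] at hre
  simp only [add_re, div_ofNat_re, ofReal_re] at hre
  rw [re_logDeriv_LFunction_inv_ofReal h1] at hre
  rw [neg_re]
  linarith

end DirichletTheta

/-! ### The bound for `−ζ'/ζ(σ)` -/

/-- **`−ζ'/ζ(σ) ≤ 1/(σ−1) − ½ log π + ½ Re ψ(σ/2 + 1)`** for real `σ > 1`: de la Vallée Poussin's
global formula `Re(−ζ'/ζ(s)) = Re 1/(s−1) − ½ log π + ½ Re ψ(s/2+1) − Σ_ρ m(ρ) Re 1/(s−ρ)`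
(`re_neg_logDeriv_zeta_hadamard`) with every term of the zero sum non-negative at `s = σ > 1`.
[cite: Kadiri2005, (1.1)] -/
theorem neg_logDeriv_riemannZeta_re_le {σ : ℝ} (hσ : 1 < σ) :
    (-(deriv riemannZeta σ / riemannZeta σ)).re ≤
      1 / (σ - 1) - Real.log Real.pi / 2 + (Complex.digamma ((σ : ℂ) / 2 + 1)).re / 2 := by
  have hζ : riemannZeta σ ≠ 0 := riemannZeta_ne_zero_of_one_lt_re (by simp only [ofReal_re]; exact hσ)
  have h0 : (σ : ℂ) ≠ 0 := by
    intro h; have := congrArg Complex.re h; simp at this; linarith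
  have h1 : (σ : ℂ) ≠ 1 := by
    intro h; have := congrArg Complex.re h; simp at this; linarith
  have h := re_neg_logDeriv_zeta_hadamard (s := σ) (by simp only [ofReal_re]; linarith) h0 h1 hζ
  have hnonneg : 0 ≤ ∑' ρ : RHWave0.riemannZetaNontrivialZeros,
      (riemannZetaZeroOrder (ρ : ℂ) : ℝ) * (1 / ((σ : ℂ) - ρ)).re := by
    refine tsum_nonneg fun ρ ↦ mul_nonneg (ZetaZeroSum.zeroOrder_nonneg ρ) ?_
    have hre1 := ZetaZeros.riemannZetaNontrivialZeros.re_lt_one ρ.2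
    rw [one_div]
    exact DirichletTheta.re_inv_ofReal_sub_nonneg (by linarith)
  have h1re : (1 / ((σ : ℂ) - 1)).re = 1 / (σ - 1) := by
    have : (1 / ((σ : ℂ) - 1)) = ((1 / (σ - 1) : ℝ) : ℂ) := by push_cast; ring
    rw [this, ofReal_re]
  rw [h1re] at h
  linarith

/-! ### The Dirichlet series `Σ Λ(n)(1 + Re χ(n)) n^{−σ}` -/

section Series

open LSeries ArithmeticFunction
open scoped LSeries.notation

variable {q : ℕ} [NeZero q] (χ : DirichletCharacter ℂ q)

omit [NeZero q] in
/-- The term identity: `Re(Λ(n)n^{−σ}) + Re(χ(n)Λ(n)n^{−σ}) = Λ(n)(1 + Re χ(n))/n^σ` for real `σ`.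
[folklore] -/
private theorem re_term_add_re_term (σ : ℝ) (n : ℕ) :
    (LSeries.term ↗Λ σ n).re + (LSeries.term (↗χ * ↗Λ) σ n).re =
      (Λ n : ℝ) * (1 + (χ (n : ZMod q)).re) / (n : ℝ) ^ σ := by
  rcases Nat.eq_zero_or_pos n with rfl | hn
  · simp [LSeries.term_zero]
  have hpow : (n : ℂ) ^ (σ : ℂ) = (((n : ℝ) ^ σ : ℝ) : ℂ) := by
    rw [Complex.ofReal_cpow (Nat.cast_nonneg n), Complex.ofReal_natCast]
  simp only [LSeries.term_of_ne_zero hn.ne', Pi.mul_apply]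
  rw [hpow, ← Complex.ofReal_div, Complex.ofReal_re, mul_div_assoc, ← Complex.ofReal_div,
    Complex.re_mul_ofReal]
  ring

/-- **`Σ_n Λ(n)(1 + Re χ(n))/n^σ = Re(−ζ'/ζ(σ)) + Re(−L'/L(σ, χ))`** for real `σ > 1`
(`−ζ'/ζ(s) = Σ Λ(n) n^{−s}`, `−L'/L(s, χ) = Σ χ(n)Λ(n) n^{−s}`, MV (1.22), (4.25)).
[cite: MontgomeryVaughan2007, §11.1 Lemma 11.2 (proof)] -/
theorem tsum_vonMangoldt_one_add_re_div_rpow_eq {σ : ℝ} (hσ : 1 < σ) :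
    ∑' n : ℕ, (Λ n : ℝ) * (1 + (χ (n : ZMod q)).re) / (n : ℝ) ^ σ =
      (-(deriv riemannZeta σ / riemannZeta σ)).re + (-(deriv χ.LFunction σ / χ.LFunction σ)).re := by
  have hs : 1 < ((σ : ℂ)).re := by simp only [ofReal_re]; exact hσ
  -- the two Dirichlet series
  have hζ : -(deriv riemannZeta σ / riemannZeta σ) = LSeries ↗Λ σ := by
    rw [ArithmeticFunction.LSeries_vonMangoldt_eq_deriv_riemannZeta_div hs, neg_div]
  have hL : -(deriv χ.LFunction σ / χ.LFunction σ) = LSeries (↗χ * ↗Λ) σ :=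
    DirichletZFR.neg_logDeriv_LFunction_eq χ hs
  have hsum1 : LSeriesSummable ↗Λ σ := ArithmeticFunction.LSeriesSummable_vonMangoldt hs
  have hsum2 : LSeriesSummable (↗χ * ↗Λ) σ := DirichletCharacter.LSeriesSummable_twist_vonMangoldt χ hs
  have hsum1' : Summable fun n ↦ (LSeries.term ↗Λ σ n).re := (Complex.hasSum_re hsum1.hasSum).summable
  have hsum2' : Summable fun n ↦ (LSeries.term (↗χ * ↗Λ) σ n).re :=
    (Complex.hasSum_re hsum2.hasSum).summable
  rw [hζ, hL, LSeries, LSeries, Complex.re_tsum hsum1, Complex.re_tsum hsum2,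
    ← Summable.tsum_add hsum1' hsum2']
  exact tsum_congr fun n ↦ (re_term_add_re_term χ σ n).symm

/-- **The global bound for the series of Lu–Zaman–Zhao's Theorem 2.1, with the partner zero.**
For a primitive `χ ≠ 1` mod `q` with parity `κ`, a real zero `β₁` of `L(s, χ)` with `0 < β₁`,
`β₁ ≠ ½`, and real `σ > 1`:
`Σ_n Λ(n)(1 + Re χ(n))/n^σ ≤ 1/(σ−1) − ½ log π + ½ Re ψ(σ/2+1) + ½ log q + Re Γ_ℝ'/Γ_ℝ(σ+κ)
 − 1/(σ−β₁) − 1/(σ−1+β₁)`. [cite: McCurley1984ZFR, Lemma 5] -/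
theorem tsum_vonMangoldt_one_add_re_div_rpow_le_of_realZero {χ : DirichletCharacter ℂ q}
    (hχ : χ.IsPrimitive) (h1 : χ ≠ 1) {β₁ : ℝ} (hβ0 : 0 < β₁) (hβhalf : β₁ ≠ 1 / 2)
    (hL : χ.LFunction β₁ = 0) {σ : ℝ} (hσ : 1 < σ) :
    ∑' n : ℕ, (Λ n : ℝ) * (1 + (χ (n : ZMod q)).re) / (n : ℝ) ^ σ ≤
      1 / (σ - 1) - Real.log Real.pi / 2 + (Complex.digamma ((σ : ℂ) / 2 + 1)).re / 2 +
        (Real.log q / 2 + (logDeriv Gammaℝ ((σ : ℂ) + charParity χ)).re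
          - 1 / (σ - β₁) - 1 / (σ - 1 + β₁)) := by
  rw [tsum_vonMangoldt_one_add_re_div_rpow_eq χ hσ]
  have hA := DirichletTheta.neg_re_logDeriv_LFunction_le_of_realZero hχ h1 hβ0 hβhalf hL hσ
  rw [logDeriv_apply] at hA
  have hB := neg_logDeriv_riemannZeta_re_le hσ
  exact add_le_add hB hA

end Series

end Literature.NumberTheory.LFunctions

end
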